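import Literature.AlgebraicGeometry.Motives.FamiliesVHSTensorMorphism
import Literature.AlgebraicGeometry.Motives.FamiliesVHSConstant
import HarnessLib

/-!
# Tensor powers `D^{⊗m}` of the data of a polarized variation of Hodge structure, pure powers `u^{⊗m}` of integral vectors, and their Hodge loci

Topic `Literature/AlgebraicGeometry/Motives` (namespace `Literature.AlgebraicGeometry.Motives.VHSData`), lane `lit-hodgefound` (seat `p08`, row g57-#6).
DEFINITIONS WITH BODIES (`VHSData.tensorPow`, the pure powers `VHSData.tpow` ∕ `tpowV`, the functoriality `VHSData.Hom.tensorPow`, the mixed tensor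
spaces `VHSData.tensorSpace`) and their API; no
named fact, no instance, no notation (D-0026 net debt `0`).  Sequel of `Motives/FamiliesVHSTensor` (`D₁ ⊗ D₂`), `Motives/FamiliesVHSConstant` (the unit
`ℤ_S`), `Motives/FamiliesVHSTensorMorphism` (`φ ⊗ ψ`, `castMap`).

PRINTED SOURCES.  P. Deligne, J. Milne, *Tannakian categories*, LNM 900 (1982), §1, 1.5–1.6: in a tensor category the iterated tensor product
`⊗_{i ∈ I} X_i` of a finite family is defined by iterating `⊗` (well defined up to the constraints), in particular `X^{⊗m}`.  P. Deligne, *Hodge cycles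
on abelian varieties* (notes by Milne), LNM 900 (1982), §3, 3.1–3.4: for a rational Hodge structure `V` the tensor spaces `V^{⊗m}` (and
`T^{m,n} = V^{⊗m} ⊗ (V^∨)^{⊗n}`) carry Hodge structures, and the Mumford–Tate group is the subgroup of `GL(V)` fixing the Hodge classes in them.
P. Deligne, *Théorie de Hodge II*, 1.1.12 (`F^p(⊗ V_i) = Σ_{Σ aᵢ = p} ⊗ F^{aᵢ} V_i`; `⊗` is multi-additive in the types `(p, q)`).  W. Schmid, *Variation of
Hodge structure*, Invent. Math. 22 (1973), §2 ∕ P. Griffiths, *Periods of integrals III*, §1: variations of Hodge structure are stable under the tensor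
operations.  E. Cattani, P. Deligne, A. Kaplan, *On the locus of Hodge classes*, J. AMS 8 (1995), §1: the Hodge loci of flat sections of the tensor
constructions on a polarizable variation.

* §0 category laws of `VHSData.Hom` used below (`comp_id`, `id_comp`, `comp_assoc`).
* §1 **`D.tensorPow m : VHSData S (m·k)`** by recursion — `D^{⊗0} = ℤ_S` (cast to weight `0·k`), `D^{⊗(m+1)} = (D^{⊗m} ⊗ D)` (cast to weight
  `(m+1)·k`); the integral ∕ rational local systems of `D^{⊗(m+1)}` are `(D^{⊗m})_ℤ ⊗ D_ℤ`, `(D^{⊗m}) ⊗ D` (`rfl`).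
* §2 **pure powers** `D.tpow s m u = u ⊗ ⋯ ⊗ u ∈ (D^{⊗m})_ℤ,s` (`u^{⊗0} = 1`) and `D.tpowV s m v` (rational): `toRat (u^{⊗m}) = (toRat u)^{⊗m}`, transport
  `γ·(u^{⊗m}) = (γ·u)^{⊗m}`, the polarization `Q^{⊗m}(x^{⊗m}, y^{⊗m}) = Q(x, y)^m`, and **`isHodgeAt_tpow`**: if `u` is a Hodge class of level `p` then
  `u^{⊗m}` is a Hodge class of level `m·p` (Hodge II 1.1.12); consequently the flat-transport Hodge locus of `u` is contained in that of `u^{⊗m}`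
  (`setOf_exists_isHodgeAt_transport_subset_tensorPow`).
* §3 **functoriality** `Hom.tensorPow φ m : D^{⊗m} → D'^{⊗m}` (`φ^{⊗0} = id`, `φ^{⊗(m+1)} = (φ^{⊗m} ⊗ φ).castMap`): value on pure powers
  `φ^{⊗m}(u^{⊗m}) = (φ u)^{⊗m}`, `id^{⊗m} = id`, `(ψ ∘ φ)^{⊗m} = ψ^{⊗m} ∘ φ^{⊗m}`.
* §4 **the mixed tensor spaces `D.tensorSpace a b = T^{a,b} D = D^{⊗a} ⊗ (D^∨)^{⊗b}`** (Deligne's `T^{a,b}`): pure tensors `u^{⊗a} ⊗ ℓ^{⊗b}` of Hodge classes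
  are Hodge classes (`isHodgeAt_tensorSpace_tpow_tmul_tpow`), their transport, and the Hodge-locus inclusion.

HONEST SCOPE: as for every `VHSData`, holomorphy ∕ transversality are not recorded.  The tensor powers here are the ITERATED BINARY tensor products of
the `VHSData` layer (`Motives/FamiliesVHSTensor`); the comparison of the fibre Hodge structures with the tree's `HodgeStructure.tensorPower` (on Mathlib's
`PiTensorProduct`) is not made in this file.

## References

* [DeligneMilne1982Tannakian] P. Deligne, J. S. Milne, *Tannakian categories*, in LNM 900 (1982), §1, 1.5–1.6.
* [Deligne1982HodgeCycles] P. Deligne, *Hodge cycles on abelian varieties*, in LNM 900 (1982), §3, 3.1–3.4.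
* [DeligneHodgeII1971] P. Deligne, *Théorie de Hodge II*, Publ. Math. IHÉS 40 (1971), 1.1.12.
* [Schmid1973] W. Schmid, *Variation of Hodge structure: the singularities of the period mapping*, Invent. Math. 22 (1973), §2.
* [Griffiths1970] P. Griffiths, *Periods of integrals on algebraic manifolds III*, Publ. Math. IHÉS 38 (1970), §1.
* [CattaniDeligneKaplan1995] E. Cattani, P. Deligne, A. Kaplan, *On the locus of Hodge classes*, J. Amer. Math. Soc. 8 (1995), §1.
* [Deligne1970] P. Deligne, *Équations différentielles à points singuliers réguliers*, LNM 163 (1970), I.1.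
-/

noncomputable section

open CategoryTheory
open scoped TensorProduct

namespace Literature.AlgebraicGeometry.Motives

namespace VHSData

variable {S : Type} [TopologicalSpace S] {k : ℤ}

/-! ## §0 Category laws of morphisms of VHS data -/

/-- `φ ∘ id = φ`. [cite: Deligne1970, I.1] -/
theorem Hom.comp_id {D₁ D₂ : VHSData S k} (φ : Hom D₁ D₂) : φ.comp (Hom.id D₁) = φ :=
  Hom.ext_of_app _ _ fun _ => LinearMap.ext fun _ => rfl

/-- `id ∘ φ = φ`. [cite: Deligne1970, I.1] -/
theorem Hom.id_comp {D₁ D₂ : VHSData S k} (φ : Hom D₁ D₂) : (Hom.id D₂).comp φ = φ :=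
  Hom.ext_of_app _ _ fun _ => LinearMap.ext fun _ => rfl

/-- `(χ ∘ ψ) ∘ φ = χ ∘ (ψ ∘ φ)`. [cite: Deligne1970, I.1] -/
theorem Hom.comp_assoc {D₁ D₂ D₃ D₄ : VHSData S k} (χ : Hom D₃ D₄) (ψ : Hom D₂ D₃) (φ : Hom D₁ D₂) :
    (χ.comp ψ).comp φ = χ.comp (ψ.comp φ) :=
  Hom.ext_of_app _ _ fun _ => LinearMap.ext fun _ => rfl

/-! ## §1 The tensor powers `D^{⊗m}` -/

/-- Weight bookkeeping: `0 = 0·k`. [folklore] -/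
private theorem tensorPow_weight_zero (k : ℤ) : (0 : ℤ) = ((0 : ℕ) : ℤ) * k := by simp

/-- Weight bookkeeping: `m·k + k = (m+1)·k`. [folklore] -/
private theorem tensorPow_weight_succ (k : ℤ) (m : ℕ) : (m : ℤ) * k + k = ((m + 1 : ℕ) : ℤ) * k := by push_cast; ring

/-- **The tensor power `D^{⊗m}` of VHS data** of weight `k`, VHS data of weight `m·k`, by recursion on `m`: `D^{⊗0} = ℤ_S` (the unit, cast from weight `0`
to weight `0·k`) and `D^{⊗(m+1)} = D^{⊗m} ⊗ D` (cast from weight `m·k + k` to `(m+1)·k`) — the iterated tensor product of the `⊗`-category of VHS data.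
[cite: DeligneMilne1982Tannakian, §1, 1.5–1.6] [cite: Deligne1982HodgeCycles, §3, 3.1] [cite: Schmid1973, §2] -/
def tensorPow (D : VHSData S k) : (m : ℕ) → VHSData S ((m : ℤ) * k)
  | 0 => (unit S).cast (tensorPow_weight_zero k)
  | m + 1 => ((tensorPow D m).tensor D).cast (tensorPow_weight_succ k m)

variable (D : VHSData S k)

/-- `D^{⊗0} = ℤ_S` (cast). [cite: DeligneMilne1982Tannakian, §1, 1.5–1.6] -/
theorem tensorPow_zero : D.tensorPow 0 = (unit S).cast (tensorPow_weight_zero k) := rfl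

/-- `D^{⊗(m+1)} = D^{⊗m} ⊗ D` (cast). [cite: DeligneMilne1982Tannakian, §1, 1.5–1.6] -/
theorem tensorPow_succ (m : ℕ) : D.tensorPow (m + 1) = ((D.tensorPow m).tensor D).cast (tensorPow_weight_succ k m) := rfl

/-- The integral local system of `D^{⊗0}` is the constant local system `ℤ_S`. [cite: Deligne1970, I.1] -/
theorem tensorPow_zero_VZ : (D.tensorPow 0).VZ = LocalSystem.const ℤ S (ModuleCat.of ℤ ℤ) := rfl

/-- The rational local system of `D^{⊗0}` is the constant local system `ℚ_S`. [cite: Deligne1970, I.1] -/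
theorem tensorPow_zero_V : (D.tensorPow 0).V = LocalSystem.const ℚ S (ModuleCat.of ℚ ℚ) := rfl

/-- The integral local system of `D^{⊗(m+1)}` is `(D^{⊗m})_ℤ ⊗ D_ℤ`. [cite: Deligne1970, I.1] -/
theorem tensorPow_succ_VZ (m : ℕ) : (D.tensorPow (m + 1)).VZ = (D.tensorPow m).VZ.tensor D.VZ := rfl

/-- The rational local system of `D^{⊗(m+1)}` is `D^{⊗m} ⊗ D`. [cite: Deligne1970, I.1] -/
theorem tensorPow_succ_V (m : ℕ) : (D.tensorPow (m + 1)).V = (D.tensorPow m).V.tensor D.V := rfl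

/-- The comparison `V_ℤ → V` of `D^{⊗(m+1)}` is that of `D^{⊗m} ⊗ D`. [cite: Schmid1973, §2] -/
theorem tensorPow_succ_toRat (m : ℕ) (s : S) : (D.tensorPow (m + 1)).toRat s = ((D.tensorPow m).tensor D).toRat s := rfl

/-- The polarization of `D^{⊗(m+1)}` is the product form of those of `D^{⊗m}` and `D`. [cite: Deligne1982HodgeCycles, §3, 3.1] -/
theorem tensorPow_succ_form_form (m : ℕ) (s : S) : ((D.tensorPow (m + 1)).form s).form = (((D.tensorPow m).tensor D).form s).form := rfl

/-! ## §2 Pure powers `u^{⊗m}` and their Hodge loci -/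

/-- **The pure power `u^{⊗m} = u ⊗ ⋯ ⊗ u ∈ (D^{⊗m})_ℤ,s`** of an integral vector `u ∈ V_ℤ,s` (`u^{⊗0} = 1 ∈ ℤ`, `u^{⊗(m+1)} = u^{⊗m} ⊗ u`).
[cite: Deligne1982HodgeCycles, §3, 3.1] -/
def tpow (D : VHSData S k) (s : S) : (m : ℕ) → D.VZ.fiber s → (D.tensorPow m).VZ.fiber s
  | 0 => fun _ => (1 : ℤ)
  | m + 1 => fun u => tpow D s m u ⊗ₜ[ℤ] u

/-- **The pure power `v^{⊗m} ∈ (D^{⊗m})_s`** of a rational vector `v ∈ V_s`. [cite: Deligne1982HodgeCycles, §3, 3.1] -/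
def tpowV (D : VHSData S k) (s : S) : (m : ℕ) → D.V.fiber s → (D.tensorPow m).V.fiber s
  | 0 => fun _ => (1 : ℚ)
  | m + 1 => fun v => tpowV D s m v ⊗ₜ[ℚ] v

/-- `u^{⊗0} = 1`. [cite: Deligne1982HodgeCycles, §3, 3.1] -/
theorem tpow_zero (s : S) (u : D.VZ.fiber s) : D.tpow s 0 u = (1 : ℤ) := rfl

/-- `u^{⊗(m+1)} = u^{⊗m} ⊗ u`. [cite: Deligne1982HodgeCycles, §3, 3.1] -/
theorem tpow_succ (s : S) (m : ℕ) (u : D.VZ.fiber s) : D.tpow s (m + 1) u = D.tpow s m u ⊗ₜ[ℤ] u := rfl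

/-- `v^{⊗0} = 1`. [cite: Deligne1982HodgeCycles, §3, 3.1] -/
theorem tpowV_zero (s : S) (v : D.V.fiber s) : D.tpowV s 0 v = (1 : ℚ) := rfl

/-- `v^{⊗(m+1)} = v^{⊗m} ⊗ v`. [cite: Deligne1982HodgeCycles, §3, 3.1] -/
theorem tpowV_succ (s : S) (m : ℕ) (v : D.V.fiber s) : D.tpowV s (m + 1) v = D.tpowV s m v ⊗ₜ[ℚ] v := rfl

/-- **`toRat (u^{⊗m}) = (toRat u)^{⊗m}`.** [cite: Schmid1973, §2] -/
theorem tensorPow_toRat_tpow (s : S) (m : ℕ) (u : D.VZ.fiber s) : (D.tensorPow m).toRat s (D.tpow s m u) = D.tpowV s m (D.toRat s u) := by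
  induction m with
  | zero => exact (unit_toRat s 1).trans (Int.cast_one : ((1 : ℤ) : ℚ) = 1)
  | succ m ih => exact congrArg (· ⊗ₜ[ℚ] D.toRat s u) ih

/-- **Integral transport of a pure power: `γ·(u^{⊗m}) = (γ·u)^{⊗m}`.** [cite: Deligne1970, I.1] -/
theorem tensorPow_VZ_transport_tpow {s t : S} (γ : Path.Homotopic.Quotient s t) (m : ℕ) (u : D.VZ.fiber s) :
    (D.tensorPow m).VZ.transport γ (D.tpow s m u) = D.tpow t m (D.VZ.transport γ u) := by
  induction m with
  | zero => rfl
  | succ m ih => exact congrArg (· ⊗ₜ[ℤ] D.VZ.transport γ u) ih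

/-- **Rational transport of a pure power: `γ·(v^{⊗m}) = (γ·v)^{⊗m}`.** [cite: Deligne1970, I.1] -/
theorem tensorPow_V_transport_tpowV {s t : S} (γ : Path.Homotopic.Quotient s t) (m : ℕ) (v : D.V.fiber s) :
    (D.tensorPow m).V.transport γ (D.tpowV s m v) = D.tpowV t m (D.V.transport γ v) := by
  induction m with
  | zero => rfl
  | succ m ih => exact congrArg (· ⊗ₜ[ℚ] D.V.transport γ v) ih

/-- **The polarization on pure powers: `Q^{⊗m}(x^{⊗m}, y^{⊗m}) = Q(x, y)^m`.** [cite: Deligne1982HodgeCycles, §3, 3.1] -/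
theorem tensorPow_form_tpowV (s : S) (m : ℕ) (x y : D.V.fiber s) :
    ((D.tensorPow m).form s).form (D.tpowV s m x) (D.tpowV s m y) = ((D.form s).form x y) ^ m := by
  induction m with
  | zero => exact (mul_one (1 : ℚ)).trans (pow_zero _).symm
  | succ m ih =>
    change (((D.tensorPow m).tensor D).form s).form (D.tpowV s m x ⊗ₜ[ℚ] x) (D.tpowV s m y ⊗ₜ[ℚ] y) = _
    rw [tensor_form_form_tmul, ih, pow_succ]

/-- **Pure powers of Hodge classes are Hodge classes**: if `u ∈ V_ℤ,s` is a Hodge class of level `p` for `D`, then `u^{⊗m}` is a Hodge class of level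
`m·p` for `D^{⊗m}` (`(F^p)^{⊗m} ⊆ F^{mp}`, Hodge II 1.1.12; `1 ∈ ℤ_S` is of type `(0,0)`). [cite: DeligneHodgeII1971, 1.1.12] [cite: Deligne1982HodgeCycles, §3, 3.4] -/
theorem isHodgeAt_tpow (s : S) {p : ℤ} {u : D.VZ.fiber s} (hu : D.IsHodgeAt s p u) (m : ℕ) :
    (D.tensorPow m).IsHodgeAt s ((m : ℤ) * p) (D.tpow s m u) := by
  induction m with
  | zero => exact ((unit S).isHodgeAt_cast_iff (tensorPow_weight_zero k) s _ (1 : ℤ)).2 ((isHodgeAt_unit_iff s _ 1).2 (Or.inl (by simp)))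
  | succ m ih =>
    have h := isHodgeAt_tensor_tmul (D.tensorPow m) D s ih hu
    have e : ((m : ℤ) * p + p) = ((m + 1 : ℕ) : ℤ) * p := by push_cast; ring
    rw [e] at h
    exact (((D.tensorPow m).tensor D).isHodgeAt_cast_iff (tensorPow_weight_succ k m) s _ _).2 h

/-- Transported form: if `γ·u` is a Hodge class of level `p` at `t`, then `γ·(u^{⊗m})` is a Hodge class of level `m·p` at `t`. [cite: CattaniDeligneKaplan1995, §1] -/
theorem isHodgeAt_transport_tpow {s t : S} (γ : Path.Homotopic.Quotient s t) {p : ℤ} {u : D.VZ.fiber s} (hu : D.IsHodgeAt t p (D.VZ.transport γ u))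
    (m : ℕ) : (D.tensorPow m).IsHodgeAt t ((m : ℤ) * p) ((D.tensorPow m).VZ.transport γ (D.tpow s m u)) := by
  rw [tensorPow_VZ_transport_tpow]
  exact D.isHodgeAt_tpow t hu m

/-- **The Hodge locus of `u` lies in the Hodge locus of `u^{⊗m}`**: the set of `t` at which some flat transport of `u` is a Hodge class of level `p` is
contained in the set of `t` at which some flat transport of `u^{⊗m}` is a Hodge class of level `m·p`. [cite: CattaniDeligneKaplan1995, §1]
[cite: Deligne1982HodgeCycles, §3, 3.4] -/
theorem setOf_exists_isHodgeAt_transport_subset_tensorPow (s : S) (p : ℤ) (u : D.VZ.fiber s) (m : ℕ) :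
    {t | ∃ γ : Path.Homotopic.Quotient s t, D.IsHodgeAt t p (D.VZ.transport γ u)} ⊆
      {t | ∃ γ : Path.Homotopic.Quotient s t, (D.tensorPow m).IsHodgeAt t ((m : ℤ) * p) ((D.tensorPow m).VZ.transport γ (D.tpow s m u))} :=
  fun _ ⟨γ, hγ⟩ => ⟨γ, D.isHodgeAt_transport_tpow γ hγ m⟩

/-! ## §3 Functoriality `φ^{⊗m} : D^{⊗m} → D'^{⊗m}` -/

/-- **`φ^{⊗m} : D^{⊗m} → D'^{⊗m}`**, the tensor power of a morphism of VHS data (`φ^{⊗0} = id_{ℤ_S}`, `φ^{⊗(m+1)} = φ^{⊗m} ⊗ φ`, casts as for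
`tensorPow`). [cite: DeligneMilne1982Tannakian, §1, 1.5–1.6] [cite: DeligneHodgeII1971, 1.1.12] -/
def Hom.tensorPow {D D' : VHSData S k} (φ : Hom D D') : (m : ℕ) → Hom (D.tensorPow m) (D'.tensorPow m)
  | 0 => Hom.id _
  | m + 1 => ((Hom.tensorPow φ m).tensor φ).castMap (tensorPow_weight_succ k m)

variable {D} {D' D'' : VHSData S k}

/-- `φ^{⊗0} = id`. [cite: DeligneMilne1982Tannakian, §1, 1.5–1.6] -/
theorem Hom.tensorPow_zero (φ : Hom D D') : Hom.tensorPow φ 0 = Hom.id _ := rfl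

/-- `φ^{⊗(m+1)} = (φ^{⊗m} ⊗ φ).castMap`. [cite: DeligneMilne1982Tannakian, §1, 1.5–1.6] -/
theorem Hom.tensorPow_succ (φ : Hom D D') (m : ℕ) :
    Hom.tensorPow φ (m + 1) = ((Hom.tensorPow φ m).tensor φ).castMap (tensorPow_weight_succ k m) := rfl

/-- On lattices `φ^{⊗(m+1)} = φ^{⊗m} ⊗ φ`. [cite: Deligne1970, I.1] -/
theorem Hom.tensorPow_succ_app (φ : Hom D D') (m : ℕ) (s : S) :
    (Hom.tensorPow φ (m + 1)).app s = TensorProduct.map ((Hom.tensorPow φ m).app s) (φ.app s) := rfl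

/-- **`φ^{⊗m}(u^{⊗m}) = (φ u)^{⊗m}`.** [cite: Deligne1982HodgeCycles, §3, 3.1] -/
theorem Hom.tensorPow_app_tpow (φ : Hom D D') (m : ℕ) (s : S) (u : D.VZ.fiber s) :
    (Hom.tensorPow φ m).app s (D.tpow s m u) = D'.tpow s m (φ.app s u) := by
  induction m with
  | zero => rfl
  | succ m ih => exact congrArg (· ⊗ₜ[ℤ] φ.app s u) ih

/-- `φ^{⊗m}` carries the Hodge class `u^{⊗m}` (for `u` Hodge of level `p`) to the Hodge class `(φ u)^{⊗m}` of level `m·p`. [cite: DeligneHodgeII1971, 1.1.12] -/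
theorem Hom.isHodgeAt_tensorPow_app_tpow (φ : Hom D D') (m : ℕ) (s : S) {p : ℤ} {u : D.VZ.fiber s} (hu : D.IsHodgeAt s p u) :
    (D'.tensorPow m).IsHodgeAt s ((m : ℤ) * p) ((Hom.tensorPow φ m).app s (D.tpow s m u)) := by
  rw [Hom.tensorPow_app_tpow]
  exact D'.isHodgeAt_tpow s (φ.isHodgeAt_app hu) m

/-- **`id^{⊗m} = id`.** [cite: DeligneMilne1982Tannakian, §1, 1.5–1.6] -/
theorem Hom.tensorPow_id (D : VHSData S k) (m : ℕ) : Hom.tensorPow (Hom.id D) m = Hom.id (D.tensorPow m) := by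
  induction m with
  | zero => rfl
  | succ m ih =>
    refine Hom.ext_of_app _ _ fun s => ?_
    rw [Hom.tensorPow_succ_app, ih, id_app, id_app, TensorProduct.map_id]
    rfl

/-- **`(ψ ∘ φ)^{⊗m} = ψ^{⊗m} ∘ φ^{⊗m}`.** [cite: DeligneMilne1982Tannakian, §1, 1.5–1.6] -/
theorem Hom.tensorPow_comp (ψ : Hom D' D'') (φ : Hom D D') (m : ℕ) :
    Hom.tensorPow (ψ.comp φ) m = (Hom.tensorPow ψ m).comp (Hom.tensorPow φ m) := by
  induction m with
  | zero => exact (Hom.comp_id _).symm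
  | succ m ih =>
    refine Hom.ext_of_app _ _ fun s => ?_
    rw [Hom.tensorPow_succ_app, ih, comp_app, comp_app, comp_app, Hom.tensorPow_succ_app, Hom.tensorPow_succ_app, TensorProduct.map_comp]
    rfl

/-! ## §4 The mixed tensor spaces `T^{a,b} D = D^{⊗a} ⊗ (D^∨)^{⊗b}` -/

/-- **`T^{a,b} D := D^{⊗a} ⊗ (D^∨)^{⊗b}`**, VHS data of weight `a·k + b·(−k)`: Deligne's tensor spaces of a Hodge structure, fibrewise along the variation
(`D^∨` the dual VHS data of `Motives/FamiliesVHSDual`). [cite: Deligne1982HodgeCycles, §3, 3.1] [cite: Schmid1973, §2] -/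
def tensorSpace (D : VHSData S k) (a b : ℕ) : VHSData S ((a : ℤ) * k + (b : ℤ) * (-k)) :=
  (D.tensorPow a).tensor (D.dual.tensorPow b)

/-- `T^{a,b} D = D^{⊗a} ⊗ (D^∨)^{⊗b}`. [cite: Deligne1982HodgeCycles, §3, 3.1] -/
theorem tensorSpace_eq (D : VHSData S k) (a b : ℕ) : D.tensorSpace a b = (D.tensorPow a).tensor (D.dual.tensorPow b) := rfl

/-- The integral local system of `T^{a,b} D` is `(D^{⊗a})_ℤ ⊗ ((D^∨)^{⊗b})_ℤ`. [cite: Deligne1970, I.1] -/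
theorem tensorSpace_VZ (D : VHSData S k) (a b : ℕ) : (D.tensorSpace a b).VZ = (D.tensorPow a).VZ.tensor (D.dual.tensorPow b).VZ := rfl

/-- **Pure tensors of Hodge classes in `T^{a,b}`**: if `u ∈ V_ℤ,s` is a Hodge class of level `p` for `D` and `ℓ ∈ (V^∨)_ℤ,s` one of level `q` for `D^∨`,
then `u^{⊗a} ⊗ ℓ^{⊗b}` is a Hodge class of level `a·p + b·q` for `T^{a,b} D`. [cite: DeligneHodgeII1971, 1.1.12] [cite: Deligne1982HodgeCycles, §3, 3.4] -/
theorem isHodgeAt_tensorSpace_tpow_tmul_tpow (D : VHSData S k) (s : S) {p q : ℤ} {u : D.VZ.fiber s} {ℓ : D.dual.VZ.fiber s}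
    (hu : D.IsHodgeAt s p u) (hℓ : D.dual.IsHodgeAt s q ℓ) (a b : ℕ) :
    (D.tensorSpace a b).IsHodgeAt s ((a : ℤ) * p + (b : ℤ) * q) (D.tpow s a u ⊗ₜ[ℤ] D.dual.tpow s b ℓ) :=
  isHodgeAt_tensor_tmul _ _ s (D.isHodgeAt_tpow s hu a) (D.dual.isHodgeAt_tpow s hℓ b)

/-- Integral transport of `u^{⊗a} ⊗ ℓ^{⊗b}` in `T^{a,b} D` is `(γ·u)^{⊗a} ⊗ (γ·ℓ)^{⊗b}`. [cite: Deligne1970, I.1] -/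
theorem tensorSpace_VZ_transport_tpow_tmul_tpow (D : VHSData S k) {s t : S} (γ : Path.Homotopic.Quotient s t) (a b : ℕ) (u : D.VZ.fiber s)
    (ℓ : D.dual.VZ.fiber s) :
    (D.tensorSpace a b).VZ.transport γ (D.tpow s a u ⊗ₜ[ℤ] D.dual.tpow s b ℓ) =
      D.tpow t a (D.VZ.transport γ u) ⊗ₜ[ℤ] D.dual.tpow t b (D.dual.VZ.transport γ ℓ) := by
  rw [← tensorPow_VZ_transport_tpow, ← tensorPow_VZ_transport_tpow]
  rfl

/-- **The common Hodge locus of `u` and `ℓ` lies in the Hodge locus of `u^{⊗a} ⊗ ℓ^{⊗b}`.** [cite: CattaniDeligneKaplan1995, §1] [cite: Deligne1982HodgeCycles, §3, 3.4] -/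
theorem setOf_exists_isHodgeAt_transport_subset_tensorSpace (D : VHSData S k) (s : S) (p q : ℤ) (u : D.VZ.fiber s) (ℓ : D.dual.VZ.fiber s) (a b : ℕ) :
    {t | ∃ γ : Path.Homotopic.Quotient s t, D.IsHodgeAt t p (D.VZ.transport γ u) ∧ D.dual.IsHodgeAt t q (D.dual.VZ.transport γ ℓ)} ⊆
      {t | ∃ γ : Path.Homotopic.Quotient s t,
        (D.tensorSpace a b).IsHodgeAt t ((a : ℤ) * p + (b : ℤ) * q) ((D.tensorSpace a b).VZ.transport γ (D.tpow s a u ⊗ₜ[ℤ] D.dual.tpow s b ℓ))} :=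
  fun t ⟨γ, hu, hℓ⟩ => ⟨γ, by
    rw [tensorSpace_VZ_transport_tpow_tmul_tpow]
    exact D.isHodgeAt_tensorSpace_tpow_tmul_tpow t hu hℓ a b⟩

end VHSData

end Literature.AlgebraicGeometry.Motives

end
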